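import Summits.QuantumFields.BalabanUV.Beta.D1BFx.NeedleGhostTadpoleRowMass
import Summits.QuantumFields.BalabanUV.Beta.D1BFx.NeedleBondMarginal

/-!
# `BalabanUV.Beta.D1BFx.NeedleGhostTadpoleRowSharp` — road «BF-x» for binder row D1, slot (K), END row `hGrp gN`, (N-2) «NT-7» SHARP FORM
# (owner FINDING U-1 ∕ ROUTE DETAIL, 2026-08-21): **THE COMPLETED GHOST TADPOLE ROW `h₇` WITH TOLERANCE `n⁴` — MET AT THE RAY OF RECORD**
# (`ωgh·x₀·cQ = 4N²a·n⁴`).  The count is organised by the BOND MARGINAL (gan24-leaf-05's `NeedleBondMarginal.sum_bond_abs_qJetAt_le_of_root`, an3 M7):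
# the displaced bond `b + w` and the base bond `b` are summed FIRST, for each fixed fine site, instead of «needle count per bond × all bonds»; the
# diagonal placements of the averaging square meet the leg's block-row |·|-mass (displayed `hM0`, = an3-g57's `sum_B_abs_Ggh_le` at distance 0, a
# corollary of `GhostLegFree.ghost_d0` — courier pending), the cross placements only its n-free sup `GhostLeg.bdd_Ggh`

HONEST DEPENDENCY (cell records, verbatim): «continuum YM on T⁴ ⇐ BetaPertH ∧ nine spine estimates (0/9 proved); BetaPertH ⇐ (D1) ∧ (D4) ∧
CAP+tail; G-an2-4 gates asym, D1 and NE2/3/4.»  HONEST FRAMING (cell contract, verbatim): «discharging `BetaPertH` makes Bałaban's UV stability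
UNCONDITIONAL — a real constructive-QFT result; it is NOT the continuum limit and NOT the Clay problem.»  THIS MODULE DISCHARGES NOTHING of the wall:
it is [folklore] finite bookkeeping BY NAME over `NeedleGhostTadpoleRow` ∕ `NeedleGhostTadpoleRowMass` (finite-support tadpole, `WghAt_offDiag`,
`T₇_eq_zero_of_far`), `NeedleBondMarginal.sum_bond_abs_qJetAt_le_of_root` (M7), `GhostLeg.bdd_Ggh` ∕ `Ggh_symm`, `GhostStencilRootedReflection.ctrHalf_mem`,
`WindowIdentification.fullSum_of_support`, leaf A6 `ContactCount.abs_weight_le_of_mem_ball`.  `hM0` and the scaling letter are DISPLAYED hypotheses,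
ruled nowhere here; the weights are ARBITRARY sequences; nothing about Bałaban's operators is asserted.  No `def`, no `def … : Prop`, nothing cited, 0 sorry.
Root-level binders hW ∕ hR-sockets ∕ hSX-socket ∕ D1Tel ∕ D1Rep — 0 discharged; (K) NOT closed; NOT D1, NOT `BetaPertH`, NOT continuum, NOT Clay.

ABSOLUTE RULE (cell charter, verbatim): «No internally-minted statement may enter as a cited fact. Every hypothesis is either kernel-proved in this
package or a verbatim quotation of a PUBLISHED theorem with page reference. The manuscript(s) under audit are NOT citable for their own disputed
steps — they are the thing under adjudication; programme-internal (2001/route/tribunal) claims are never citable.»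

WHY (owner d1-p2-g9 FINDING U-1, journal 2026-08-21 ≈09:40Z: at the ray of record `(cK, cQ, x₀) = (c·n², c·a, −c)`, `ωgh·cK² = −4N²n⁸` ⇒ `ωgh·x₀·cQ = 4N²a·n⁴`;
v1's letter (`·n² ≤ k`) is short by n⁶, the second form's (`≤ k·n²`) by n²; «the remaining n² sits in the DISPLACEMENT and BASE sums: only the `n^{4−μ}`
μ-bonds of the block that carry a needle contribute, and only the fraction `n^{−ν}` of base bonds carries a ν-needle — organise both with M7 … That lands at
`|ωgh·x₀·cQ| ≤ k·n⁴` (= `4N²a ≤ k`: MET)»).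

CONTENT (all [folklore]; `Y := blk (n−1) u′`, `J_u x := qJetAt ρ n κ u Y x`, `J′ x := qJetAt ρ n l u′ Y x`, `S := 2∕min 2 a`).
* §1 **`abs_tadpole_qSqAt_le_placements`** (`|tadpole (Ggh) (qSqAt ρ n κ u l u′)| ≤ 2M·Σ_{x∈B(Y)}|J_u x|·|J′ x| + 2S·(Σ_x|J_u x|)·(Σ_x|J′ x|)`),
  **`abs_T₇_le_placements`** (the word at `w ≠ 0`, × `½|x₀cQ|n⁴`).
* §2 at a base bond: `sum_ball_abs_qJetAt_le` (M7 over the displaced bond, any fixed fine site: `≤ (n−1)·n⁻⁴`), **`abs_fullSum_T₇_le_sharp`**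
  (`|n⁻⁸·fullSum_b| ≤ |x₀cQ|·(n⁻⁴·((n−1)³·((M·n⁻⁴ + S)·Σ_x |J′_b x|)))`).
* §3 over the base bonds: `blk_resSite` (`blk (resSite r) = 0`), `sum_resSite_abs_qJetAt_le` (M7 over the base bond), **`abs_row₇_le_sharp`**, and in the glue's
  currency **`h₇_sharp (ha) (hM0) (hk : |ωgh n·(x₀ n·cQ n)| ≤ k·n⁴) ⊢ h₇` VERBATIM, `C₇ := k·(cM + 2∕min 2 a)`**.
Unit `b2b-balaban-beta-d1-formalise-leaf-04` (gen 8), D1 formalisation swarm; `LEAVES-BFx.md` row (N) ∕ «NT-7».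
-/

noncomputable section

namespace Summit.QuantumFields.BalabanUV.Beta.D1BFx.NeedleGhostTadpoleRowSharp

open Finset Filter Topology
open scoped BigOperators
open Literature.MathematicalPhysics.QuantumFieldTheory.Balaban1983to89
open Literature.MathematicalPhysics.QuantumFieldTheory.Balaban1983to89.Beta
open B6QGQLower276 (blk B mem_B side)
open ExpKernelCalculus (Site MKer tadpole)
open Literature.Probability.LatticeModels (annulus)
open DyadicShell (Pt toReal supNorm mem_annulus_iff supNorm_eq_zero_iff)
open WindowIdentification (psum fullSum fullSum_of_support)
open DressedMomentNormalisation (resSite)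
open KernelReflection (tadpole_smul)
open Summit.QuantumFields.BalabanUV.Beta.D1BFx.DressedTablesLeg (tadpoleTableA tadpoleTableA_apply)
open Summit.QuantumFields.BalabanUV.Beta.D1BFx.ContactCount (abs_weight_le_of_mem_ball)
open Summit.QuantumFields.BalabanUV.Beta.D1BFx.GhostLeg (Ggh bdd_Ggh Ggh_symm side_pred)
open Summit.QuantumFields.BalabanUV.Beta.D1BFx.GhostStencilRooted (qJetAt qAntiAt qAntiAt_apply)
open Summit.QuantumFields.BalabanUV.Beta.D1BFx.GhostStencilRootedReflection (ctrHalf ctrHalf_mem)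
open Summit.QuantumFields.BalabanUV.Beta.D1BFx.GhostAveragingSquare (qSqAt qSqAt_apply WghAt)
open Summit.QuantumFields.BalabanUV.Beta.D1BFx.GhostNeedleRootedLetters (sum_B_const')
open Summit.QuantumFields.BalabanUV.Beta.D1BFx.NeedleBondMarginal (sum_bond_abs_qJetAt_le_of_root)
open Summit.QuantumFields.BalabanUV.Beta.D1BFx.NeedleGhostTadpoleRow (qSqAt_eq_zero_of_not_mem_left qSqAt_eq_zero_of_not_mem_right WghAt_offDiag
  T₇_eq_zero_of_far)
open Summit.QuantumFields.BalabanUV.Beta.D1BFx.NeedleGhostTadpoleRowMass (abs_tadpole_le_sum_of_support)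

/-! ## §1 The averaging-square tadpole by placements: diagonal → block-row mass, cross → sup -/

section Placements

variable (ρ : Site 4) (n : ℕ) [NeZero n] {a : ℝ}

/-- [folklore] **THE GHOST TADPOLE OF THE AVERAGING SQUARE BY PLACEMENTS.**  On the common block `B(Y)`, `Y = blk u′`, write each stripped jet as
`qAntiAt … z x = J x − J z` (`J x := qJetAt … Y x`); of the four placements of `|J_u|·|J′|` against `|Ggh x z|`, the two DIAGONAL ones meet ONE block-row
(resp. block-column, `Ggh_symm`) |·|-mass `M` of the leg, the two CROSS ones only its sup `2∕min 2 a`: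
`|tadpole (Ggh n a) (qSqAt ρ n κ u l u′)| ≤ 2M·Σ_x |J_u x|·|J′ x| + 2·(2∕min 2 a)·(Σ_x |J_u x|)·(Σ_x |J′ x|)`. -/
theorem abs_tadpole_qSqAt_le_placements (ha : 0 < a) (κ : Fin 4) (u : Site 4) (l : Fin 4) (u' : Site 4) {M : ℝ}
    (hM : ∀ x : Site 4, ∑ z ∈ B (n - 1) (blk (n - 1) u'), |Ggh n a x z () ()| ≤ M) :
    |tadpole (Ggh n a) (qSqAt ρ n κ u l u')| ≤
      2 * M * ∑ x ∈ B (n - 1) (blk (n - 1) u'), |qJetAt ρ n κ u (blk (n - 1) u') x| * |qJetAt ρ n l u' (blk (n - 1) u') x|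
      + 2 * (2 / min 2 a) *
        ((∑ x ∈ B (n - 1) (blk (n - 1) u'), |qJetAt ρ n κ u (blk (n - 1) u') x|) *
          ∑ x ∈ B (n - 1) (blk (n - 1) u'), |qJetAt ρ n l u' (blk (n - 1) u') x|) := by
  set Y := blk (n - 1) u' with hY
  set T := B (n - 1) Y with hT
  set J : Site 4 → ℝ := fun x => |qJetAt ρ n κ u Y x| with hJ
  set J' : Site 4 → ℝ := fun x => |qJetAt ρ n l u' Y x| with hJ'
  set G : Site 4 → Site 4 → ℝ := fun x z => |Ggh n a x z () ()| with hG
  set S : ℝ := 2 / min 2 a with hSdef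
  have hm : 0 < min 2 a := lt_min (by norm_num) ha
  have hS0 : 0 ≤ S := by positivity
  have hGS : ∀ x z, G x z ≤ S := fun x z => bdd_Ggh n a ha x z () ()
  have hG0 : ∀ x z, 0 ≤ G x z := fun x z => abs_nonneg _
  have hJ0 : ∀ x, 0 ≤ J x := fun x => abs_nonneg _
  have hJ'0 : ∀ x, 0 ≤ J' x := fun x => abs_nonneg _
  have hM0 : 0 ≤ M := (Finset.sum_nonneg fun z _ => abs_nonneg _).trans (hM 0)
  have hrow : ∀ x, ∑ z ∈ T, G x z ≤ M := fun x => hM x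
  have hcol : ∀ z, ∑ x ∈ T, G x z ≤ M := by
    intro z
    have e : ∑ x ∈ T, G x z = ∑ x ∈ T, |Ggh n a z x () ()| :=
      Finset.sum_congr rfl fun x _ => by simp only [hG]; rw [Ggh_symm n a ha x z () ()]
    rw [e]; exact hM z
  -- the square on the block: `|qSqAt z x| ≤ (J x + J z)·(J′ x + J′ z)`
  have hq : ∀ x ∈ T, ∀ z ∈ T, |qSqAt ρ n κ u l u' z x () ()| ≤ (J x + J z) * (J' x + J' z) := by
    intro x hx z hz
    have hbx : blk (n - 1) x = Y := mem_B.1 hx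
    have hbz : blk (n - 1) z = Y := mem_B.1 hz
    rw [qSqAt_apply, abs_mul, qAntiAt_apply, qAntiAt_apply, hbx, hbz]
    exact mul_le_mul (abs_sub _ _) (abs_sub _ _) (abs_nonneg _) (add_nonneg (hJ0 x) (hJ0 z))
  have h0 := abs_tadpole_le_sum_of_support (A := Ggh n a) (V := qSqAt ρ n κ u l u') T
    (fun y hy x f a' => qSqAt_eq_zero_of_not_mem_left ρ n κ u l u' y hy x f a')
    (fun x hx y f a' => qSqAt_eq_zero_of_not_mem_right ρ n κ u l u' x hx y f a')
  have h1 : ∑ x ∈ T, ∑ a' : Unit, ∑ z ∈ T, ∑ f' : Unit, |Ggh n a x z a' f'| * |qSqAt ρ n κ u l u' z x f' a'|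
      = ∑ x ∈ T, ∑ z ∈ T, G x z * |qSqAt ρ n κ u l u' z x () ()| := by
    simp only [Fintype.sum_unique, PUnit.default_eq_unit]
    rfl
  have expand : ∀ x z, G x z * ((J x + J z) * (J' x + J' z)) =
      G x z * (J x * J' x) + G x z * (J x * J' z) + G x z * (J z * J' x) + G x z * (J z * J' z) := fun x z => by ring
  -- the four placements
  have p1 : ∑ x ∈ T, ∑ z ∈ T, G x z * (J x * J' x) ≤ M * ∑ x ∈ T, J x * J' x := by
    calc ∑ x ∈ T, ∑ z ∈ T, G x z * (J x * J' x) = ∑ x ∈ T, (J x * J' x) * ∑ z ∈ T, G x z := by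
          refine Finset.sum_congr rfl fun x _ => ?_
          rw [Finset.mul_sum]; exact Finset.sum_congr rfl fun z _ => by ring
      _ ≤ ∑ x ∈ T, (J x * J' x) * M := Finset.sum_le_sum fun x _ => mul_le_mul_of_nonneg_left (hrow x) (mul_nonneg (hJ0 x) (hJ'0 x))
      _ = M * ∑ x ∈ T, J x * J' x := by rw [Finset.mul_sum]; exact Finset.sum_congr rfl fun x _ => by ring
  have p4 : ∑ x ∈ T, ∑ z ∈ T, G x z * (J z * J' z) ≤ M * ∑ x ∈ T, J x * J' x := by
    rw [Finset.sum_comm]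
    calc ∑ z ∈ T, ∑ x ∈ T, G x z * (J z * J' z) = ∑ z ∈ T, (J z * J' z) * ∑ x ∈ T, G x z := by
          refine Finset.sum_congr rfl fun z _ => ?_
          rw [Finset.mul_sum]; exact Finset.sum_congr rfl fun x _ => by ring
      _ ≤ ∑ z ∈ T, (J z * J' z) * M := Finset.sum_le_sum fun z _ => mul_le_mul_of_nonneg_left (hcol z) (mul_nonneg (hJ0 z) (hJ'0 z))
      _ = M * ∑ x ∈ T, J x * J' x := by rw [Finset.mul_sum]; exact Finset.sum_congr rfl fun x _ => by ring
  have p2 : ∑ x ∈ T, ∑ z ∈ T, G x z * (J x * J' z) ≤ S * ((∑ x ∈ T, J x) * ∑ x ∈ T, J' x) := by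
    calc ∑ x ∈ T, ∑ z ∈ T, G x z * (J x * J' z) ≤ ∑ x ∈ T, ∑ z ∈ T, S * (J x * J' z) :=
          Finset.sum_le_sum fun x _ => Finset.sum_le_sum fun z _ => mul_le_mul_of_nonneg_right (hGS x z) (mul_nonneg (hJ0 x) (hJ'0 z))
      _ = S * ((∑ x ∈ T, J x) * ∑ x ∈ T, J' x) := by
          rw [Finset.sum_mul_sum, Finset.mul_sum]
          exact Finset.sum_congr rfl fun x _ => by rw [Finset.mul_sum]
  have p3 : ∑ x ∈ T, ∑ z ∈ T, G x z * (J z * J' x) ≤ S * ((∑ x ∈ T, J x) * ∑ x ∈ T, J' x) := by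
    calc ∑ x ∈ T, ∑ z ∈ T, G x z * (J z * J' x) ≤ ∑ x ∈ T, ∑ z ∈ T, S * (J z * J' x) :=
          Finset.sum_le_sum fun x _ => Finset.sum_le_sum fun z _ => mul_le_mul_of_nonneg_right (hGS x z) (mul_nonneg (hJ0 z) (hJ'0 x))
      _ = S * ((∑ x ∈ T, J x) * ∑ x ∈ T, J' x) := by
          rw [Finset.sum_comm, Finset.sum_mul_sum, Finset.mul_sum]
          exact Finset.sum_congr rfl fun z _ => by rw [Finset.mul_sum]
  calc |tadpole (Ggh n a) (qSqAt ρ n κ u l u')|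
      ≤ ∑ x ∈ T, ∑ z ∈ T, G x z * |qSqAt ρ n κ u l u' z x () ()| := h1 ▸ h0
    _ ≤ ∑ x ∈ T, ∑ z ∈ T, G x z * ((J x + J z) * (J' x + J' z)) :=
        Finset.sum_le_sum fun x hx => Finset.sum_le_sum fun z hz => mul_le_mul_of_nonneg_left (hq x hx z hz) (hG0 x z)
    _ = (∑ x ∈ T, ∑ z ∈ T, G x z * (J x * J' x)) + (∑ x ∈ T, ∑ z ∈ T, G x z * (J x * J' z))
        + (∑ x ∈ T, ∑ z ∈ T, G x z * (J z * J' x)) + (∑ x ∈ T, ∑ z ∈ T, G x z * (J z * J' z)) := by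
        simp only [expand, Finset.sum_add_distrib]
    _ ≤ M * (∑ x ∈ T, J x * J' x) + S * ((∑ x ∈ T, J x) * ∑ x ∈ T, J' x)
        + S * ((∑ x ∈ T, J x) * ∑ x ∈ T, J' x) + M * (∑ x ∈ T, J x * J' x) := add_le_add (add_le_add (add_le_add p1 p2) p3) p4
    _ = 2 * M * (∑ x ∈ T, J x * J' x) + 2 * S * ((∑ x ∈ T, J x) * ∑ x ∈ T, J' x) := by ring

variable (x₀ cK cQ : ℝ)

/-- [folklore] **THE COMPLETED GHOST TADPOLE WORD BY PLACEMENTS** (`w ≠ 0`: the kinetic contact has dropped, `WghAt_offDiag`):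
`|tadpoleTableA (Ggh n a) (WghAt ρ n x₀ cK cQ) μ ν (b+w) b| ≤ ½·|x₀cQ|·n⁴·(2M·Σ_x |J_{b+w} x|·|J′_b x| + 2S·(Σ_x|J_{b+w} x|)·(Σ_x|J′_b x|))`, jets rooted at
`Y = blk b`. -/
theorem abs_T₇_le_placements (ha : 0 < a) (μ ν : Fin 4) (b : Pt) {w : Pt} (hw : w ≠ 0) {M : ℝ}
    (hM : ∀ x : Site 4, ∑ z ∈ B (n - 1) (blk (n - 1) b), |Ggh n a x z () ()| ≤ M) :
    |tadpoleTableA (Ggh n a) (WghAt ρ n x₀ cK cQ) μ ν (b + w) b| ≤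
      1 / 2 * (|x₀ * cQ| * (n : ℝ) ^ 4) *
        (2 * M * ∑ x ∈ B (n - 1) (blk (n - 1) b), |qJetAt ρ n μ (b + w) (blk (n - 1) b) x| * |qJetAt ρ n ν b (blk (n - 1) b) x|
          + 2 * (2 / min 2 a) *
            ((∑ x ∈ B (n - 1) (blk (n - 1) b), |qJetAt ρ n μ (b + w) (blk (n - 1) b) x|) *
              ∑ x ∈ B (n - 1) (blk (n - 1) b), |qJetAt ρ n ν b (blk (n - 1) b) x|)) := by
  have hn : (0 : ℝ) < n := by exact_mod_cast Nat.pos_of_ne_zero (NeZero.ne n)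
  have hbw : b + w ≠ b := fun e => hw (by simpa using e)
  rw [tadpoleTableA_apply, WghAt_offDiag ρ n x₀ cK cQ μ ν hbw, tadpole_smul, abs_mul, abs_mul,
    abs_of_pos (by norm_num : (0 : ℝ) < 1 / 2)]
  have hc : |(-(x₀ * cQ * (n : ℝ) ^ 4))| = |x₀ * cQ| * (n : ℝ) ^ 4 := by
    rw [abs_neg, abs_mul, abs_of_pos (pow_pos hn 4)]
  rw [hc]
  have hP := abs_tadpole_qSqAt_le_placements ρ n ha μ (b + w) ν b hM
  calc 1 / 2 * (|x₀ * cQ| * (n : ℝ) ^ 4 * |tadpole (Ggh n a) (qSqAt ρ n μ (b + w) ν b)|)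
      ≤ 1 / 2 * (|x₀ * cQ| * (n : ℝ) ^ 4 *
        (2 * M * ∑ x ∈ B (n - 1) (blk (n - 1) b), |qJetAt ρ n μ (b + w) (blk (n - 1) b) x| * |qJetAt ρ n ν b (blk (n - 1) b) x|
          + 2 * (2 / min 2 a) *
            ((∑ x ∈ B (n - 1) (blk (n - 1) b), |qJetAt ρ n μ (b + w) (blk (n - 1) b) x|) *
              ∑ x ∈ B (n - 1) (blk (n - 1) b), |qJetAt ρ n ν b (blk (n - 1) b) x|))) := by gcongr
    _ = _ := by ring

end Placements
/-! ## §2 At a base bond: the displaced bond summed first (M7) -/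

section Base

variable (n : ℕ) [NeZero n] {a : ℝ} (x₀ cK cQ : ℝ)

/-- [folklore] **THE DISPLACED-BOND SUM OF THE ROOTED JET** (M7 over the ball, any fixed root block and fine site): for the centred root,
`Σ_{w ∈ ball(n−1)} |qJetAt (ctrHalf n) n μ (b + w) Y x| ≤ (n−1)·n⁻⁴` (`NeedleBondMarginal.sum_bond_abs_qJetAt_le_of_root` on the translated ball). -/
theorem sum_ball_abs_qJetAt_le (μ : Fin 4) (b Y x : Site 4) :
    ∑ w ∈ annulus 4 0 (n - 1), |qJetAt (ctrHalf n) n μ (b + w) Y x| ≤ ((n : ℝ) - 1) * ((n : ℝ) ^ 4)⁻¹ := by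
  have hinj : Set.InjOn (fun w : Pt => b + w) ↑(annulus 4 0 (n - 1)) := fun w _ w' _ h => add_left_cancel h
  have e : ∑ w ∈ annulus 4 0 (n - 1), |qJetAt (ctrHalf n) n μ (b + w) Y x| =
      ∑ u ∈ (annulus 4 0 (n - 1)).image (fun w : Pt => b + w), |qJetAt (ctrHalf n) n μ u Y x| := by
    rw [Finset.sum_image hinj]
  rw [e]
  exact sum_bond_abs_qJetAt_le_of_root n μ (fun i => ctrHalf_mem n i) _ Y x

/-- [folklore] **THE COMPLETED GHOST TADPOLE ROW AT A BASE BOND, SHARP**: with `Y = blk b`, `J′_b x := qJetAt (ctrHalf n) n ν b Y x`, the leg's block-row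
|·|-mass `M` on `B(Y)` and `S = 2∕min 2 a`:
`|n⁻⁸ · fullSum (w ↦ w_μw_ν·T₇(b+w,b))| ≤ |x₀cQ|·(n⁻⁴·((n−1)³·((M·n⁻⁴ + S)·Σ_{x ∈ B(Y)} |J′_b x|)))` — the full sum IS the finite sum over the ball of
radius `n − 1` (`fullSum_of_support`), the (1.22) weight costs `(n−1)²`, and the displaced bond is summed FIRST (`sum_ball_abs_qJetAt_le`). -/
theorem abs_fullSum_T₇_le_sharp (ha : 0 < a) (μ ν : Fin 4) (b : Pt) {M : ℝ}
    (hM : ∀ x : Site 4, ∑ z ∈ B (n - 1) (blk (n - 1) b), |Ggh n a x z () ()| ≤ M) :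
    |((n : ℝ) ^ 8)⁻¹ * fullSum (fun w : Pt => toReal w μ * toReal w ν *
        tadpoleTableA (Ggh n a) (WghAt (ctrHalf n) n x₀ cK cQ) μ ν (b + w) b)| ≤
      |x₀ * cQ| * (((n : ℝ) ^ 4)⁻¹ * ((((n - 1 : ℕ) : ℝ)) ^ 2 * (((n : ℝ) - 1) *
        ((M * ((n : ℝ) ^ 4)⁻¹ + 2 / min 2 a) * ∑ x ∈ B (n - 1) (blk (n - 1) b), |qJetAt (ctrHalf n) n ν b (blk (n - 1) b) x|)))) := by
  have hn1 : (1 : ℝ) ≤ n := by exact_mod_cast NeZero.one_le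
  have hn : (0 : ℝ) < n := by linarith
  have hm : 0 < min 2 a := lt_min (by norm_num) ha
  have hM0 : 0 ≤ M := (Finset.sum_nonneg fun z _ => abs_nonneg _).trans (hM 0)
  set Y := blk (n - 1) b with hY
  set A : ℝ := ∑ x ∈ B (n - 1) Y, |qJetAt (ctrHalf n) n ν b Y x| with hA
  have hA0 : 0 ≤ A := Finset.sum_nonneg fun x _ => abs_nonneg _
  set K : Pt → ℝ := fun w => toReal w μ * toReal w ν * tadpoleTableA (Ggh n a) (WghAt (ctrHalf n) n x₀ cK cQ) μ ν (b + w) b with hK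
  have hfar : ∀ w : Pt, n - 1 < supNorm w → K w = 0 := fun w hw => by
    simp only [hK]; rw [T₇_eq_zero_of_far (ctrHalf n) n x₀ cK cQ μ ν b w hw, mul_zero]
  rw [fullSum_of_support hfar]
  -- pointwise on the ball: weight `(n−1)²` × placements
  have hpt : ∀ w ∈ annulus 4 0 (n - 1), |K w| ≤ (((n - 1 : ℕ) : ℝ)) ^ 2 * (1 / 2 * (|x₀ * cQ| * (n : ℝ) ^ 4) *
      (2 * M * ∑ x ∈ B (n - 1) Y, |qJetAt (ctrHalf n) n μ (b + w) Y x| * |qJetAt (ctrHalf n) n ν b Y x|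
        + 2 * (2 / min 2 a) * ((∑ x ∈ B (n - 1) Y, |qJetAt (ctrHalf n) n μ (b + w) Y x|) * A))) := by
    intro w hw
    have hw0 : w ≠ 0 := fun e => by
      have h1 := (mem_annulus_iff.mp hw).1
      rw [e, supNorm_eq_zero_iff.mpr rfl] at h1
      exact lt_irrefl _ h1
    simp only [hK]
    rw [abs_mul]
    exact mul_le_mul (abs_weight_le_of_mem_ball hw μ ν) (abs_T₇_le_placements (ctrHalf n) n x₀ cK cQ ha μ ν b hw0 hM) (abs_nonneg _)
      (by positivity)
  -- the displaced-bond sums (M7)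
  have hD : ∑ w ∈ annulus 4 0 (n - 1), ∑ x ∈ B (n - 1) Y, |qJetAt (ctrHalf n) n μ (b + w) Y x| * |qJetAt (ctrHalf n) n ν b Y x|
      ≤ ((n : ℝ) - 1) * ((n : ℝ) ^ 4)⁻¹ * A := by
    rw [Finset.sum_comm]
    calc ∑ x ∈ B (n - 1) Y, ∑ w ∈ annulus 4 0 (n - 1), |qJetAt (ctrHalf n) n μ (b + w) Y x| * |qJetAt (ctrHalf n) n ν b Y x|
        = ∑ x ∈ B (n - 1) Y, (∑ w ∈ annulus 4 0 (n - 1), |qJetAt (ctrHalf n) n μ (b + w) Y x|) * |qJetAt (ctrHalf n) n ν b Y x| := by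
          refine Finset.sum_congr rfl fun x _ => by rw [Finset.sum_mul]
      _ ≤ ∑ x ∈ B (n - 1) Y, (((n : ℝ) - 1) * ((n : ℝ) ^ 4)⁻¹) * |qJetAt (ctrHalf n) n ν b Y x| :=
          Finset.sum_le_sum fun x _ => mul_le_mul_of_nonneg_right (sum_ball_abs_qJetAt_le n μ b Y x) (abs_nonneg _)
      _ = ((n : ℝ) - 1) * ((n : ℝ) ^ 4)⁻¹ * A := by rw [← Finset.mul_sum]
  have hAA : ∑ w ∈ annulus 4 0 (n - 1), (∑ x ∈ B (n - 1) Y, |qJetAt (ctrHalf n) n μ (b + w) Y x|) ≤ ((n : ℝ) - 1) := by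
    rw [Finset.sum_comm]
    calc ∑ x ∈ B (n - 1) Y, ∑ w ∈ annulus 4 0 (n - 1), |qJetAt (ctrHalf n) n μ (b + w) Y x|
        ≤ ∑ _x ∈ B (n - 1) Y, ((n : ℝ) - 1) * ((n : ℝ) ^ 4)⁻¹ := Finset.sum_le_sum fun x _ => sum_ball_abs_qJetAt_le n μ b Y x
      _ = (n : ℝ) ^ 4 * (((n : ℝ) - 1) * ((n : ℝ) ^ 4)⁻¹) := sum_B_const' n Y _
      _ = (n : ℝ) - 1 := by field_simp
  -- assemble
  have hsum : ∑ w ∈ annulus 4 0 (n - 1), |K w| ≤ (((n - 1 : ℕ) : ℝ)) ^ 2 * (1 / 2 * (|x₀ * cQ| * (n : ℝ) ^ 4) *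
      (2 * M * (((n : ℝ) - 1) * ((n : ℝ) ^ 4)⁻¹ * A) + 2 * (2 / min 2 a) * (((n : ℝ) - 1) * A))) := by
    refine (Finset.sum_le_sum hpt).trans ?_
    rw [← Finset.mul_sum, ← Finset.mul_sum]
    refine mul_le_mul_of_nonneg_left (mul_le_mul_of_nonneg_left ?_ (by positivity)) (by positivity)
    rw [Finset.sum_add_distrib, ← Finset.mul_sum, ← Finset.mul_sum]
    refine add_le_add (mul_le_mul_of_nonneg_left hD (by positivity)) (mul_le_mul_of_nonneg_left ?_ (by positivity))
    rw [← Finset.sum_mul]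
    exact mul_le_mul_of_nonneg_right hAA hA0
  rw [abs_mul, abs_of_nonneg (by positivity : (0 : ℝ) ≤ ((n : ℝ) ^ 8)⁻¹)]
  calc ((n : ℝ) ^ 8)⁻¹ * |∑ w ∈ annulus 4 0 (n - 1), K w|
      ≤ ((n : ℝ) ^ 8)⁻¹ * ∑ w ∈ annulus 4 0 (n - 1), |K w| :=
        mul_le_mul_of_nonneg_left (Finset.abs_sum_le_sum_abs _ _) (by positivity)
    _ ≤ ((n : ℝ) ^ 8)⁻¹ * ((((n - 1 : ℕ) : ℝ)) ^ 2 * (1 / 2 * (|x₀ * cQ| * (n : ℝ) ^ 4) *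
      (2 * M * (((n : ℝ) - 1) * ((n : ℝ) ^ 4)⁻¹ * A) + 2 * (2 / min 2 a) * (((n : ℝ) - 1) * A)))) :=
        mul_le_mul_of_nonneg_left hsum (by positivity)
    _ = |x₀ * cQ| * (((n : ℝ) ^ 4)⁻¹ * ((((n - 1 : ℕ) : ℝ)) ^ 2 * (((n : ℝ) - 1) *
        ((M * ((n : ℝ) ^ 4)⁻¹ + 2 / min 2 a) * A)))) := by
        field_simp

end Base

/-! ## §3 Over the base bonds: the base bond summed first (M7); `h₇` with tolerance `n⁴` -/

section Row

variable (n : ℕ) [NeZero n]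

/-- [folklore] The residue sites lie in the block of the origin: `blk (n−1) (resSite r) = 0`. -/
theorem blk_resSite (r : Fin 4 → Fin n) : blk (n - 1) (resSite (d := 4) (N := n) r) = 0 := by
  funext i
  simp only [blk, side_pred n, resSite, Pi.zero_apply]
  exact Int.ediv_eq_zero_of_lt (by positivity) (by exact_mod_cast (r i).isLt)

/-- [folklore] **THE BASE-BOND SUM OF THE ROOTED JET** (M7 over the residue sites, root block `0`): `Σ_{b ∈ image resSite} |qJetAt (ctrHalf n) n ν b 0 x| ≤ (n−1)·n⁻⁴`. -/
theorem sum_resSite_abs_qJetAt_le (ν : Fin 4) (x : Site 4) :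
    ∑ b ∈ (univ : Finset (Fin 4 → Fin n)).image resSite, |qJetAt (ctrHalf n) n ν b 0 x| ≤ ((n : ℝ) - 1) * ((n : ℝ) ^ 4)⁻¹ :=
  sum_bond_abs_qJetAt_le_of_root n ν (fun i => ctrHalf_mem n i) _ 0 x

variable {a : ℝ} (x₀ cK cQ : ℝ)

/-- [folklore] **THE COMPLETED GHOST TADPOLE ROW AT FIXED `n`, SHARP**: with the leg's block-row |·|-mass `M` on the block of the origin and `S = 2∕min 2 a`,
`|ωgh · Σ_{b ∈ image resSite} n⁻⁴·(n⁻⁸·fullSum (…))| ≤ |ωgh|·(|x₀cQ|·(n⁻⁸·((n−1)²·((n−1)²·(M·n⁻⁴ + S)))))` —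
the base bond summed by M7 for each fine site of the block. -/
theorem abs_row₇_le_sharp (ha : 0 < a) (ωgh : ℝ) (μ ν : Fin 4) {M : ℝ}
    (hM : ∀ x : Site 4, ∑ z ∈ B (n - 1) 0, |Ggh n a x z () ()| ≤ M) :
    |ωgh * ∑ b ∈ (univ : Finset (Fin 4 → Fin n)).image resSite, ((n : ℝ) ^ 4)⁻¹ * (((n : ℝ) ^ 8)⁻¹ *
        fullSum (fun w : Pt => toReal w μ * toReal w ν * tadpoleTableA (Ggh n a) (WghAt (ctrHalf n) n x₀ cK cQ) μ ν (b + w) b))| ≤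
      |ωgh| * (|x₀ * cQ| * (((n : ℝ) ^ 8)⁻¹ * ((((n - 1 : ℕ) : ℝ)) ^ 2 * (((n : ℝ) - 1) ^ 2 * (M * ((n : ℝ) ^ 4)⁻¹ + 2 / min 2 a))))) := by
  have hn1 : (1 : ℝ) ≤ n := by exact_mod_cast NeZero.one_le
  have hn : (0 : ℝ) < n := by linarith
  have hm : 0 < min 2 a := lt_min (by norm_num) ha
  have hM0 : 0 ≤ M := (Finset.sum_nonneg fun z _ => abs_nonneg _).trans (hM 0)
  set R := (univ : Finset (Fin 4 → Fin n)).image (resSite (d := 4) (N := n)) with hR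
  -- every base site sits in the block of the origin
  have hblk : ∀ b ∈ R, blk (n - 1) b = 0 := by
    intro b hb
    obtain ⟨r, _, rfl⟩ := Finset.mem_image.1 hb
    exact blk_resSite n r
  -- per base bond (§2), with `Y = 0`
  have hb : ∀ b ∈ R, |((n : ℝ) ^ 4)⁻¹ * (((n : ℝ) ^ 8)⁻¹ *
      fullSum (fun w : Pt => toReal w μ * toReal w ν * tadpoleTableA (Ggh n a) (WghAt (ctrHalf n) n x₀ cK cQ) μ ν (b + w) b))| ≤
      ((n : ℝ) ^ 4)⁻¹ * (|x₀ * cQ| * (((n : ℝ) ^ 4)⁻¹ * ((((n - 1 : ℕ) : ℝ)) ^ 2 * (((n : ℝ) - 1) *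
        ((M * ((n : ℝ) ^ 4)⁻¹ + 2 / min 2 a) * ∑ x ∈ B (n - 1) 0, |qJetAt (ctrHalf n) n ν b 0 x|))))) := by
    intro b hbR
    have hY := hblk b hbR
    have hMb : ∀ x : Site 4, ∑ z ∈ B (n - 1) (blk (n - 1) b), |Ggh n a x z () ()| ≤ M := by rw [hY]; exact hM
    have h := abs_fullSum_T₇_le_sharp n x₀ cK cQ ha μ ν b hMb
    rw [hY] at h
    rw [abs_mul, abs_of_nonneg (by positivity : (0 : ℝ) ≤ ((n : ℝ) ^ 4)⁻¹)]
    exact mul_le_mul_of_nonneg_left h (by positivity)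
  -- the base-bond sum by M7, fine site by fine site
  have hBase : ∑ b ∈ R, ∑ x ∈ B (n - 1) 0, |qJetAt (ctrHalf n) n ν b 0 x| ≤ (n : ℝ) ^ 4 * (((n : ℝ) - 1) * ((n : ℝ) ^ 4)⁻¹) := by
    rw [Finset.sum_comm]
    calc ∑ x ∈ B (n - 1) 0, ∑ b ∈ R, |qJetAt (ctrHalf n) n ν b 0 x|
        ≤ ∑ _x ∈ B (n - 1) 0, ((n : ℝ) - 1) * ((n : ℝ) ^ 4)⁻¹ := Finset.sum_le_sum fun x _ => sum_resSite_abs_qJetAt_le n ν x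
      _ = (n : ℝ) ^ 4 * (((n : ℝ) - 1) * ((n : ℝ) ^ 4)⁻¹) := sum_B_const' n 0 _
  rw [abs_mul]
  refine mul_le_mul_of_nonneg_left ?_ (abs_nonneg ωgh)
  set c : ℝ := ((n : ℝ) ^ 4)⁻¹ * (|x₀ * cQ| * (((n : ℝ) ^ 4)⁻¹ * ((((n - 1 : ℕ) : ℝ)) ^ 2 * (((n : ℝ) - 1) *
        (M * ((n : ℝ) ^ 4)⁻¹ + 2 / min 2 a))))) with hc
  have hc0 : 0 ≤ c := by positivity
  calc |∑ b ∈ R, ((n : ℝ) ^ 4)⁻¹ * (((n : ℝ) ^ 8)⁻¹ *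
        fullSum (fun w : Pt => toReal w μ * toReal w ν * tadpoleTableA (Ggh n a) (WghAt (ctrHalf n) n x₀ cK cQ) μ ν (b + w) b))|
      ≤ ∑ b ∈ R, |((n : ℝ) ^ 4)⁻¹ * (((n : ℝ) ^ 8)⁻¹ *
        fullSum (fun w : Pt => toReal w μ * toReal w ν * tadpoleTableA (Ggh n a) (WghAt (ctrHalf n) n x₀ cK cQ) μ ν (b + w) b))| :=
        Finset.abs_sum_le_sum_abs _ _
    _ ≤ ∑ b ∈ R, c * ∑ x ∈ B (n - 1) 0, |qJetAt (ctrHalf n) n ν b 0 x| := by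
        refine Finset.sum_le_sum fun b hbR => (hb b hbR).trans (le_of_eq ?_)
        simp only [hc]; ring
    _ = c * ∑ b ∈ R, ∑ x ∈ B (n - 1) 0, |qJetAt (ctrHalf n) n ν b 0 x| := by rw [Finset.mul_sum]
    _ ≤ c * ((n : ℝ) ^ 4 * (((n : ℝ) - 1) * ((n : ℝ) ^ 4)⁻¹)) := mul_le_mul_of_nonneg_left hBase hc0
    _ = |x₀ * cQ| * (((n : ℝ) ^ 8)⁻¹ * ((((n - 1 : ℕ) : ℝ)) ^ 2 * (((n : ℝ) - 1) ^ 2 * (M * ((n : ℝ) ^ 4)⁻¹ + 2 / min 2 a)))) := by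
        simp only [hc]; field_simp

end Row

/-! ## §3′ In the glue's currency -/

section Glue

variable {a : ℝ} {x₀ cK cQ ωgh : ℕ → ℝ} {k cM : ℝ}

/-- [folklore] **«NT-7» SHARP: THE COMPLETED GHOST TADPOLE ROW `h₇` WITH TOLERANCE `n⁴`** — displayed: `0 < a`; the block-row |·|-mass letter of the ghost leg
at block distance 0, `hM0 : ∀ n ≥ 2, ∀ x Y, Σ_{z ∈ B(Y)} |Ggh n a x z| ≤ cM` (n-free `cM`; = an3-g57's `sum_B_abs_Ggh_le` at distance 0, courier pending —
displayed here, not minted); and ONE scaling letter `|ωgh n · (x₀ n · cQ n)| ≤ k · n⁴` — MET at the ray of record (`4N²a ≤ k`, owner U-1).  Output = `h₇` of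
`NeedleRowGlue.abs_gN_row_le_of_tables` VERBATIM with `C₇ := k · (cM + 2∕min 2 a)`. -/
theorem h₇_sharp (ha : 0 < a)
    (hM0 : ∀ n : ℕ, 2 ≤ n → ∀ [NeZero n], ∀ x Y : Site 4, ∑ z ∈ B (n - 1) Y, |Ggh n a x z () ()| ≤ cM)
    (hk : ∀ n : ℕ, 2 ≤ n → |ωgh n * (x₀ n * cQ n)| ≤ k * (n : ℝ) ^ 4) (μ ν : Fin 4) :
    ∀ n : ℕ, 2 ≤ n → ∀ [NeZero n], |ωgh n * ∑ b ∈ (univ : Finset (Fin 4 → Fin n)).image resSite, ((n : ℝ) ^ 4)⁻¹ * (((n : ℝ) ^ 8)⁻¹ *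
      fullSum (fun w : Pt => toReal w μ * toReal w ν *
        tadpoleTableA (Ggh n a) (WghAt (ctrHalf n) n (x₀ n) (cK n) (cQ n)) μ ν (b + w) b))| ≤ k * (cM + 2 / min 2 a) := by
  intro n hn _
  have h1 : 1 ≤ n := le_trans (by norm_num) hn
  have hn1 : (1 : ℝ) ≤ n := by exact_mod_cast h1
  have hn0 : (0 : ℝ) < n := by linarith
  have hm : 0 < min 2 a := lt_min (by norm_num) ha
  have hcM : 0 ≤ cM := (Finset.sum_nonneg fun z _ => abs_nonneg _).trans (hM0 n hn 0 0)
  refine (abs_row₇_le_sharp n (x₀ n) (cK n) (cQ n) ha (ωgh n) μ ν (fun x => hM0 n hn x 0)).trans ?_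
  -- `n⁻⁸·(n−1)²·(n−1)² ≤ n⁻⁴`, `M·n⁻⁴ ≤ M`
  have e1 : ((n - 1 : ℕ) : ℝ) = (n : ℝ) - 1 := by rw [Nat.cast_sub h1, Nat.cast_one]
  have hp : ((n : ℝ) ^ 8)⁻¹ * ((((n - 1 : ℕ) : ℝ)) ^ 2 * ((n : ℝ) - 1) ^ 2) ≤ ((n : ℝ) ^ 4)⁻¹ := by
    rw [e1, ← pow_add, show (2 + 2 : ℕ) = 4 by norm_num]
    have h4 : ((n : ℝ) - 1) ^ 4 ≤ (n : ℝ) ^ 4 := pow_le_pow_left₀ (by linarith) (by linarith) 4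
    calc ((n : ℝ) ^ 8)⁻¹ * ((n : ℝ) - 1) ^ 4 ≤ ((n : ℝ) ^ 8)⁻¹ * (n : ℝ) ^ 4 := mul_le_mul_of_nonneg_left h4 (by positivity)
      _ = ((n : ℝ) ^ 4)⁻¹ := by field_simp
  have hMS : cM * ((n : ℝ) ^ 4)⁻¹ + 2 / min 2 a ≤ cM + 2 / min 2 a := by
    have : cM * ((n : ℝ) ^ 4)⁻¹ ≤ cM := by
      rw [← div_eq_mul_inv]
      exact div_le_self hcM (one_le_pow₀ hn1)
    linarith
  have hMS0 : 0 ≤ cM * ((n : ℝ) ^ 4)⁻¹ + 2 / min 2 a := by positivity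
  have hk0 : 0 ≤ k * (n : ℝ) ^ 4 := (abs_nonneg _).trans (hk n hn)
  calc |ωgh n| * (|x₀ n * cQ n| * (((n : ℝ) ^ 8)⁻¹ * ((((n - 1 : ℕ) : ℝ)) ^ 2 * (((n : ℝ) - 1) ^ 2 * (cM * ((n : ℝ) ^ 4)⁻¹ + 2 / min 2 a)))))
      = |ωgh n * (x₀ n * cQ n)| * ((((n : ℝ) ^ 8)⁻¹ * ((((n - 1 : ℕ) : ℝ)) ^ 2 * ((n : ℝ) - 1) ^ 2)) * (cM * ((n : ℝ) ^ 4)⁻¹ + 2 / min 2 a)) := by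
        rw [abs_mul (ωgh n)]; ring
    _ ≤ (k * (n : ℝ) ^ 4) * (((n : ℝ) ^ 4)⁻¹ * (cM + 2 / min 2 a)) :=
        mul_le_mul (hk n hn) (mul_le_mul hp hMS hMS0 (by positivity)) (by positivity) hk0
    _ = k * (cM + 2 / min 2 a) := by field_simp

end Glue

end Summit.QuantumFields.BalabanUV.Beta.D1BFx.NeedleGhostTadpoleRowSharp

end
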